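import Summits.HodgeConjecture.HodgeConjecture.Theorems.FirstOrderSemiregularSeedsFirstOrderWeilSeedsEightCLfDesignPad4
import Literature.NumberTheory.EllipticCurves.CMEndomorphismOfMulMemLattice
import HarnessLib

/-!
# Route `FirstOrderSemiregularSeeds`, crux X2‴ `FirstOrderWeilSeedsEightCS` (stmt-HodgeConjecture-24864) / aside X2′
# `FirstOrderWeilSeedsEightC` (stmt-HodgeConjecture-23714): the CLASS HALF in closed form —
# `Hartshorne1977_serre_subbundleOfTwists → ∀ C, ∀ d > 0, HasHyperbolicSeedOn (f.l.f. κ-designs of C) 4 d`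

HONEST FRAMING. Nothing here proves X2‴, X2′, X1, rung H2, HC for abelian varieties or the Hodge conjecture; the FIRST-ORDER
(lift) half of the crux is untouched. This file only assembles, for the record and for the line's next skeleton, the class-level
content of X2‴ as ONE closed statement: MODULO the displayed Chern-character-free named fact
`Literature.AlgebraicGeometry.Modules.Hartshorne1977_serre_subbundleOfTwists` (route binder K-S, stmt-HodgeConjecture-24863;
Hartshorne II Thm. 5.17), for EVERY Chern character theory `C : ChernCharacterBetti` and every `d ≥ 1` there is a HYPERBOLIC
`√-d`-Weil eightfold carrying a non-zero rational Weil class `w` and a FINITE LOCALLY FREE κ-design for `q·h_K⁴ + w`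
(`ch_p ∈ ℚ·h_Kᵖ` for `p ≠ 4`, `p ≤ 8`) — i.e. `HasHyperbolicSeedOn 𝒪 4 d` for every object class `𝒪` containing the f.l.f.
κ-designs of `C` (the skeletons' `lfDesignClass C`, whose lambda is repeated verbatim in
`hasHyperbolicSeedOn_lfDesign_four_of_serre`). Ingredients, all in the tree: the CM curve `(E₀, ψ₀)`, `ψ₀² = -d`
(`exists_cmCurve_sqrt_neg`), the pinned anchor `S_d⁴ = (E₀²)⁴` with `Ψ = (ψ₀ × (−ψ₀))⁴` (`pad4Anchor_hyperbolic_weilClass`: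
`dim = 8`, `Ψ² = -d`), and the class half modulo Serre on that anchor (`kappaDesign_pad4_of_serre`, hodge-fos-kappa-p1 g0).

Why the Serre hypothesis is displayed and not discharged: the tree's Mathlib pin has no twisting sheaves `𝒪_{ℙⁿ}(m)` as
`Scheme.Modules` objects and no global generation of coherent twists; and no axioms-only substitute exists — every module whose
`IsFiniteLocallyFree` and `C.ch` the axioms control is an ℕ-combination (sums, extensions, pull-backs) of SPAN witnesses with
unknown Chern classes off one degree, and finite-group averaging on `S_d⁴` always leaves the invariant `h_AA ∪ h_BB ∉ ℚ·h_K²`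
(memo `class-half-obstruction.md`, evidence on stmt-HodgeConjecture-23714).

## References

[cite: Hartshorne1977, II Thm. 5.17 and Cor. 5.18] [cite: Fulton1998, Example 3.2.3 and Example 15.2.16 (b)]
[cite: vanGeemen1994HodgeAV, 4.3, 5.2–5.4] [cite: Markman2025SurveySecant, §11.5 Step 2]
-/

noncomputable section

-- single-problem summit (Problem = Summit): the mandated namespace repeats `HodgeConjecture`.
set_option linter.dupNamespace false

open CategoryTheory AlgebraicGeometry
open Literature.AlgebraicGeometry Literature.AlgebraicGeometry.Motives Literature.AlgebraicGeometry.HodgeTheory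
open Literature.AlgebraicGeometry.Modules (Hartshorne1977_serre_subbundleOfTwists)
open Summit.Ventures.HSemireg

namespace Summit.HodgeConjecture.HodgeConjecture.Theorems

/-- **Class half of X2‴ in closed form, MODULO Serre's sub-bundle theorem** (CONDITIONAL on the named fact
`Hartshorne1977_serre_subbundleOfTwists` only): for every Chern character theory `C`, every object class `𝒪` containing the
finite-locally-free κ-designs of `C` in relative dimension `8` (all nine degrees `I = {0,…,8}`, abelian fibre), and every
`d ≥ 1`, `HasHyperbolicSeedOn 𝒪 4 d`: the pinned CM anchor `S_d⁴ = (E₀ × E₀)⁴`, `Ψ = (ψ₀ × (−ψ₀))⁴`, `ψ₀² = -d`, is a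
hyperbolic `√-d`-Weil eightfold for a `K`-symmetrised hyperplane class `h_K = d·e^*a + Ψ^*e^*a` and carries a non-zero
rational Weil class `w` with an `𝒪`-seed for `q·h_K⁴ + w`. Assembles `exists_cmCurve_sqrt_neg`,
`pad4Anchor_hyperbolic_weilClass` and `kappaDesign_pad4_of_serre`. Says nothing about first-order liftability.
[cite: Hartshorne1977, II Thm. 5.17] [cite: vanGeemen1994HodgeAV, 5.2–5.4] [cite: Markman2025SurveySecant, §11.5 Step 2] -/
theorem hasHyperbolicSeedOn_four_of_serre (hS : Hartshorne1977_serre_subbundleOfTwists) (C : ChernCharacterBetti)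
    (𝒪 : ObjClass)
    (h𝒪 : ∀ (X₀ : SchemeOver ℂ) (I : Finset ℕ) (κ : (p : ℕ) → complexBetti X₀ (2 * p)),
      I = Finset.range (2 * 4 + 1) → (∃ P₀ : AbelianVariety ℂ, Nonempty (X₀ ≅ P₀.X)) →
      (∃ (F : X₀.left.Modules) (_ : IsFiniteLocallyFree F), ∀ p ∈ I, κ p = C.ch X₀ F p) → 𝒪 (2 * 4) X₀ I κ)
    {d : ℕ} (hd : 0 < d) : HasHyperbolicSeedOn 𝒪 4 d := by
  obtain ⟨E₀, ψ₀, hE, hψ⟩ :=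
    Literature.NumberTheory.EllipticCurves.CMEndomorphism.exists_cmCurve_sqrt_neg d hd
  obtain ⟨hP8, hsq, -, -⟩ := pad4Anchor_hyperbolic_weilClass hE hd hψ _ rfl
  obtain ⟨e, a, w, ha, ha0, hhyp, hwW, hwQ, hw0, hseed⟩ := kappaDesign_pad4_of_serre hS C 𝒪 h𝒪 hd hE hψ _ rfl
  exact ⟨_, _, e, a, w, hP8, hsq, ha, ha0, hhyp, hwW, hwQ, hw0, hseed⟩

/-- **Class half of X2‴ for the skeletons' design class, verbatim** (CONDITIONAL on `Hartshorne1977_serre_subbundleOfTwists`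
only): `HasHyperbolicSeedOn (lfDesignClass C) 4 d` for every `C` and `d ≥ 1`, where the object class is the lambda of
`Cruxes/FirstOrderWeilSeedsEight/Lines/birthC.lean`'s `lfDesignClass C` written out (`I = {0,…,n}`, abelian fibre, an f.l.f.
`E₀` with `κ_p = ch_p(E₀)` on `I`) — the route lambda `𝒪_C` with the first-order clause deleted. A skeleton obtains its
class-half statement from this by `exact` (definitional unfolding of `lfDesignClass`).
[cite: Hartshorne1977, II Thm. 5.17] [cite: BuchweitzFlenner2003, §5 (sheaf data shape)] -/
theorem hasHyperbolicSeedOn_lfDesign_four_of_serre (hS : Hartshorne1977_serre_subbundleOfTwists) (C : ChernCharacterBetti)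
    {d : ℕ} (hd : 0 < d) :
    HasHyperbolicSeedOn
      (fun (n : ℕ) (X₀ : Literature.AlgebraicGeometry.Motives.SchemeOver ℂ) (I : Finset ℕ)
        (κ : (p : ℕ) → Literature.AlgebraicGeometry.HodgeTheory.complexBetti X₀ (2 * p)) =>
        I = Finset.range (n + 1) ∧
        (∃ P₀ : Literature.AlgebraicGeometry.Motives.AbelianVariety ℂ, Nonempty (X₀ ≅ P₀.X)) ∧
        ∃ (E₀ : X₀.left.Modules) (_ : Literature.AlgebraicGeometry.Motives.IsFiniteLocallyFree E₀),
          (∀ p ∈ I, κ p = C.ch X₀ E₀ p))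
      4 d :=
  hasHyperbolicSeedOn_four_of_serre hS C _ (fun _ _ _ h₁ h₂ h₃ ↦ ⟨h₁, h₂, h₃⟩) hd

end Summit.HodgeConjecture.HodgeConjecture.Theorems

end
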